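import Literature.AlgebraicGeometry.Resolution.ResidueTranscendentalExtensions
import Literature.AlgebraicGeometry.Resolution.FiniteRankOverPrimeField
import Literature.AlgebraicGeometry.Resolution.FrobeniusClosedBases
import Mathlib.Order.Zorn
import HarnessLib

/-!
# A discretely valued subfield `K₀ ⊆ K` with the same residue field (Kuhlmann 2010, Lemma 4.11)

Topic: `Literature/AlgebraicGeometry/Resolution` (valued function fields). First step of the
mixed characteristic construction of a lifted Frobenius-closed basis, F.-V. Kuhlmann,
*Elimination of ramification I: The generalized stability theorem*, Trans. AMS 362 (2010)
5697–5727 = arXiv:1003.5678, §4.2, **Lemma 4.11** (towards the named fact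
`Kuhlmann2010Prop413ResidueDegree` through `IsDenseLiftedFrobeniusClosedBasis`,
`DenseLiftedFrobeniusClosedBasis.lean`; p. 15 of the arXiv version):

> In this case, `K` contains `ℚ` and its valuation induces the `p`-adic valuation `v_p` on `ℚ`.
> Since `K` is algebraically closed, it contains a subfield `K₀` such that `K̄₀ = K̄` and
> `vK₀ = v_pℚ = ℤvp`; this field can be constructed as follows. Take `𝒯` to be a set of preimages
> for a transcendence basis `𝒯̄` of `K̄|𝔽_p`; then `𝒯` is an algebraically valuation independent
> set and we have `ℚ(𝒯)‾ = 𝔽_p(𝒯̄)` and `vℚ(𝒯) = vℚ` by Lemma 2.5. Now `K̄|ℚ(𝒯)‾` is an algebraic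
> extension which can be viewed as a (transfinite) tower of finite separable and finite purely
> inseparable extensions. By induction we successively lift all of these extensions, preserving
> their degrees. … since all of them have the same degree as the corresponding extensions of
> their residue fields, the fundamental inequality shows that they preserve the value group as
> `ℚ(𝒯)`, which is `ℤvp`. The union over this tower is the desired field `K₀`.

## Content (everything PROVED)

* `valuation_natCast_eq_one_of_not_dvd`, `exists_valuation_natCast_eq_pow`,
  `exists_valuation_eq_zpow_of_mem_bot` — "its valuation induces the `p`-adic valuation on `ℚ`":
  the non-zero elements of the prime field have values in `v(p)^ℤ` (`char Ω = 0`, `char Ωv = p`).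
* `exists_lift_of_isAlgebraic_residue` — the algebraic lifting step, uniformly for `K`
  algebraically closed (no separable/inseparable distinction and no Hensel's Lemma: the minimal
  polynomial of the residue lifts to a monic polynomial which splits in `K` with roots in `V`, one
  of which has the right residue), with the degree bound `[L(a):L] ≤ [Lv(r̄):Lv]`;
  `natDegree_minpoly_le_relfinrank_residue` — `[Lv(r̄):Lv] ≤ [L(a)v : Lv]`.
* `exists_subfield_discrete_residueSubfield_eq` — **the subfield `K₀`**, by Zorn's lemma instead
  of the printed transfinite tower: a subfield `L ≤ K` maximal with `vL ⊆ v(p)^ℤ` has `Lv = Kv`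
  (the transcendental step is Lemma 2.5, `valueSubgroup_adjoin_eq_of_isResidueTranscendental`;
  the algebraic step keeps `vL` by the fundamental inequality).

## Sources

* F.-V. Kuhlmann, *Elimination of ramification I: The generalized stability theorem*, Trans.
  Amer. Math. Soc. 362 (2010) 5697–5727 = arXiv:1003.5678: §1 (1) (fundamental inequality),
  §2.1 Lemma 2.5, §4.2 Lemma 4.11 and its proof (p. 15). [Kuhlmann2010]

## Rendering notes

* Ambient rendering: `(Ω, V)`, `K ≤ Ω` a subfield which is an algebraically closed field;
  `char Ω = 0` (`CharZero Ω`), `char Ωv = p` (`CharP (ResidueField V) p`). "`vK₀ = ℤvp`" is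
  rendered as: every non-zero element of `K₀` has value `v(p)^n` for some `n ∈ ℤ` (so `vK₀` is
  the cyclic group generated by `v(p) < 1`); "`K̄₀ = K̄`" as `residueSubfield K V ≤ residueSubfield K₀ V`
  (the other inclusion being `K₀ ≤ K`).
-/

noncomputable section

open IsLocalRing

namespace Literature.AlgebraicGeometry.Resolution

universe u

variable {Ω : Type u} [Field Ω] (V : ValuationSubring Ω)

/-! ### Values on the prime field -/

section PrimeField

variable {p : ℕ} [hp : Fact p.Prime] [CharP (ResidueField V) p]

omit hp in
/-- A natural number prime to `p` is a unit of `V` (`char Ωv = p`). [folklore] -/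
theorem valuation_natCast_eq_one_of_not_dvd {m : ℕ} (hm : ¬ p ∣ m) : V.valuation (m : Ω) = 1 := by
  have hle : V.valuation (m : Ω) ≤ 1 := (V.valuation_le_one_iff _).mpr (natCast_mem V m)
  refine le_antisymm hle ?_
  by_contra hlt
  push Not at hlt
  have h0 : residue V (m : V) = 0 := by
    rw [residue_eq_zero_iff]
    exact (V.valuation_lt_one_iff _).mpr (by simpa using hlt)
  rw [map_natCast, CharP.cast_eq_zero_iff (ResidueField V) p] at h0
  exact hm h0

/-- The value of a non-zero natural number is a power of `v(p)`. [folklore] -/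
theorem exists_valuation_natCast_eq_pow {m : ℕ} (hm : m ≠ 0) :
    ∃ n : ℕ, V.valuation (m : Ω) = V.valuation (p : Ω) ^ n := by
  obtain ⟨e, m', hm', rfl⟩ := Nat.exists_eq_pow_mul_and_not_dvd hm p hp.out.ne_one
  refine ⟨e, ?_⟩
  rw [Nat.cast_mul, Nat.cast_pow, map_mul, map_pow, valuation_natCast_eq_one_of_not_dvd V hm', mul_one]

/-- **The prime field is discretely valued by `v(p)`**: every non-zero element of the prime
subfield of `Ω` (of characteristic `0`) has value `v(p)^n`, `n ∈ ℤ` (Kuhlmann 2010, proof of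
Lemma 4.11: "its valuation induces the `p`-adic valuation `v_p` on `ℚ` … `vK₀ = v_pℚ = ℤvp`").
PROVED. [cite: Kuhlmann2010, Lemma 4.11 (proof)] -/
theorem exists_valuation_eq_zpow_of_mem_bot [CharZero Ω] {b : Ω} (hb : b ∈ (⊥ : Subfield Ω)) (hb0 : b ≠ 0) :
    ∃ n : ℤ, V.valuation b = V.valuation (p : Ω) ^ n := by
  obtain ⟨m, n, hn, -, rfl⟩ := exists_int_div_nat_of_mem_bot hb
  have hm0 : m ≠ 0 := by
    rintro rfl
    exact hb0 (by simp)
  have hp0 : V.valuation (p : Ω) ≠ 0 := by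
    rw [map_ne_zero]
    exact Nat.cast_ne_zero.mpr hp.out.ne_zero
  obtain ⟨e₁, he₁⟩ := exists_valuation_natCast_eq_pow V (Int.natAbs_ne_zero.mpr hm0)
  obtain ⟨e₂, he₂⟩ := exists_valuation_natCast_eq_pow V hn.ne'
  refine ⟨(e₁ : ℤ) - e₂, ?_⟩
  have hm : V.valuation (m : Ω) = V.valuation (p : Ω) ^ e₁ := by
    rw [← he₁]
    rcases Int.natAbs_eq m with h | h
    · conv_lhs => rw [h]
      simp
    · conv_lhs => rw [h]
      simp
  rw [map_div₀, hm, he₂, zpow_sub₀ hp0, zpow_natCast, zpow_natCast]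

end PrimeField

/-! ### Lifting residues: the transcendental and the algebraic step -/

section Steps

variable {V}
variable {p : ℕ} [hp : Fact p.Prime]

omit hp in
/-- The property "`vL ⊆ v(p)^ℤ`" of a subfield `L`. Values of `L'` lie in `v(p)^ℤ` as soon as
`vL' ≤ vL`. [folklore] -/
theorem forall_valuation_eq_zpow_of_valueSubgroup_le {L L' : Subfield Ω}
    (hL : ∀ a ∈ L, a ≠ 0 → ∃ n : ℤ, V.valuation a = V.valuation (p : Ω) ^ n)
    (hle : valueSubgroup L' V ≤ valueSubgroup L V) :
    ∀ a ∈ L', a ≠ 0 → ∃ n : ℤ, V.valuation a = V.valuation (p : Ω) ^ n := by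
  intro a ha ha0
  have hva : V.valuation a ≠ 0 := (map_ne_zero _).mpr ha0
  have hmem : Units.mk0 _ hva ∈ valueSubgroup L' V :=
    (mem_valueSubgroup_iff L' V _).mpr ⟨⟨a, ha⟩, fun h => ha0 (congrArg Subtype.val h), rfl⟩
  obtain ⟨c, hc0, hc⟩ := (mem_valueSubgroup_iff L V _).mp (hle hmem)
  rw [Units.val_mk0] at hc
  obtain ⟨n, hn⟩ := hL c c.2 (fun h => hc0 (Subtype.ext h))
  exact ⟨n, hc.trans hn⟩

/-- A monic polynomial `X^n + ∑_{k<n} c_k X^k` with coefficients of value `≤ 1` has all its roots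
in `V`. [folklore] -/
theorem valuation_le_one_of_root {n : ℕ} (c : ℕ → Ω) (hc : ∀ k, V.valuation (c k) ≤ 1) {a : Ω}
    (ha : a ^ n + ∑ k ∈ Finset.range n, c k * a ^ k = 0) : V.valuation a ≤ 1 := by
  by_contra hlt
  push Not at hlt
  have hsum : V.valuation (∑ k ∈ Finset.range n, c k * a ^ k) < V.valuation a ^ n := by
    refine Valuation.map_sum_lt _ (pow_ne_zero _ (ne_of_gt (lt_trans zero_lt_one hlt))) fun k hk => ?_
    rw [Finset.mem_range] at hk
    rw [map_mul, map_pow]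
    calc V.valuation (c k) * V.valuation a ^ k ≤ 1 * V.valuation a ^ k := mul_le_mul_left (hc k) _
      _ = V.valuation a ^ k := one_mul _
      _ < V.valuation a ^ n := pow_lt_pow_right₀ hlt hk
  have : V.valuation (a ^ n + ∑ k ∈ Finset.range n, c k * a ^ k) = V.valuation a ^ n := by
    rw [Valuation.map_add_eq_of_lt_left _ (by rwa [map_pow]), map_pow]
  rw [ha, map_zero] at this
  exact pow_ne_zero _ (ne_of_gt (lt_trans zero_lt_one hlt)) this.symm

/-- **The residue degree bounds the degree of a residue**: for subfields `A ≤ B` of `Ω` with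
`[Bv : Av]` finite and `r ∈ Bv` algebraic over `Av`, `deg minpoly_{Av}(r) ≤ [Bv : Av]`. [folklore] -/
theorem natDegree_minpoly_le_relfinrank_residue {A B : Subfield Ω} (hAB : A ≤ B)
    (hfin : 0 < (residueSubfield A V).relfinrank (residueSubfield B V)) {r : ResidueField V}
    (hr : r ∈ residueSubfield B V) (halg : IsAlgebraic (residueSubfield A V) r) :
    (minpoly (residueSubfield A V) r).natDegree ≤ (residueSubfield A V).relfinrank (residueSubfield B V) := by
  have hle : residueSubfield A V ≤ residueSubfield B V := residueSubfield_subfield_mono hAB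
  rw [Subfield.relfinrank_eq_finrank_of_le hle] at hfin ⊢
  haveI : FiniteDimensional (residueSubfield A V) (Subfield.extendScalars hle) :=
    Module.finite_of_finrank_pos hfin
  have hadj : IntermediateField.adjoin (residueSubfield A V) ({r} : Set (ResidueField V)) ≤
      Subfield.extendScalars hle :=
    IntermediateField.adjoin_simple_le_iff.mpr ((Subfield.mem_extendScalars (h := hle)).mpr hr)
  rw [← IntermediateField.adjoin.finrank halg.isIntegral]
  exact IntermediateField.finrank_le_of_le_right hadj

/-- **The algebraic lifting step** (Kuhlmann 2010, proof of Lemma 4.11: "The separable extensions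
are lifted by Hensel's Lemma … The purely inseparable extensions can be lifted using our assumption
that `K` is closed under `p`-th roots … since all of them have the same degree as the
corresponding extensions of their residue fields, the fundamental inequality shows that they
preserve the value group"; here uniformly for `K` algebraically closed, without Hensel's Lemma:
lift the minimal polynomial of `r̄` over `Lv` to a monic `g` over `L ∩ V`; `g` splits in `K` with
roots in `V`, whose residues are the roots of `ḡ`, so one of them has residue `r̄`). For `L ≤ K`,
`K` algebraically closed, and `r̄ ∈ Kv` algebraic over `Lv`: there is `a ∈ K ∩ V` with residue
`r̄` and `[L(a) : L] ≤ deg minpoly_{Lv}(r̄)`. PROVED. [cite: Kuhlmann2010, Lemma 4.11 (proof)] -/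
theorem exists_lift_of_isAlgebraic_residue {K L : Subfield Ω} (hK : IsAlgClosed K) (hLK : L ≤ K)
    {r : ResidueField V} (hrK : r ∈ residueSubfield K V) (halg : IsAlgebraic (residueSubfield L V) r) :
    ∃ a ∈ K, a ∈ V ∧ resid V a = r ∧ ∃ _ : L ≤ (IntermediateField.adjoin L ({a} : Set Ω)).toSubfield,
      0 < Subfield.relfinrank L (IntermediateField.adjoin L ({a} : Set Ω)).toSubfield ∧
      Subfield.relfinrank L (IntermediateField.adjoin L ({a} : Set Ω)).toSubfield ≤
        (minpoly (residueSubfield L V) r).natDegree := by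
  classical
  set kL := residueSubfield L V with hkL
  set q := minpoly kL r with hq
  have hqmonic : q.Monic := minpoly.monic halg.isIntegral
  set n := q.natDegree with hn
  -- lift the coefficients of `q` to `L ∩ V`
  have hcoef : ∀ k, ∃ c ∈ L, c ∈ V ∧ resid V c = ((q.coeff k : kL) : ResidueField V) := fun k =>
    exists_resid_eq_of_mem_residueSubfield V (q.coeff k).2
  choose c hcL hcV hc using hcoef
  -- the lifted polynomial over `L`, and its images over `K` and `Ω`
  set gL : Polynomial L := Polynomial.X ^ n + ∑ k ∈ Finset.range n, Polynomial.C (⟨c k, hcL k⟩ : L) * Polynomial.X ^ k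
    with hgL
  have hdeg : (∑ k ∈ Finset.range n, Polynomial.C (⟨c k, hcL k⟩ : L) * Polynomial.X ^ k).degree <
      (n : WithBot ℕ) := by
    refine (Polynomial.degree_sum_le _ _).trans_lt ?_
    refine (Finset.sup_lt_iff (WithBot.bot_lt_coe n)).mpr fun k hk => ?_
    rw [Finset.mem_range] at hk
    exact (Polynomial.degree_C_mul_X_pow_le k _).trans_lt (WithBot.coe_lt_coe.mpr hk)
  have hgLmonic : gL.Monic := Polynomial.monic_X_pow_add hdeg
  have hgL0 : gL ≠ 0 := hgLmonic.ne_zero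
  have hgLdeg : gL.natDegree = n := by
    rw [hgL, Polynomial.natDegree_add_eq_left_of_degree_lt, Polynomial.natDegree_X_pow]
    rwa [Polynomial.degree_X_pow]
  -- evaluation in `Ω`
  have heval : ∀ z : Ω, (gL.map (algebraMap L Ω)).eval z = z ^ n + ∑ k ∈ Finset.range n, c k * z ^ k := by
    intro z
    rw [hgL]
    simp only [Polynomial.map_add, Polynomial.map_pow, Polynomial.map_X, Polynomial.map_sum,
      Polynomial.map_mul, Polynomial.map_C, Polynomial.eval_add, Polynomial.eval_pow, Polynomial.eval_X,
      Polynomial.eval_finsetSum, Polynomial.eval_mul, Polynomial.eval_C]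
    rfl
  -- over `K` it splits, with roots in `V`
  set gK : Polynomial K := gL.map (Subfield.inclusion hLK) with hgK
  have hgKmonic : gK.Monic := hgLmonic.map _
  have hsplit := (IsAlgClosed.splits gK).eq_prod_roots_of_monic hgKmonic
  have hmapK : gK.map (algebraMap K Ω) = gL.map (algebraMap L Ω) := by
    rw [hgK, Polynomial.map_map]
    rfl
  have hevalK : ∀ z : Ω, (gL.map (algebraMap L Ω)).eval z = (gK.roots.map fun α : K => z - (α : Ω)).prod := by
    intro z
    have h1 : (gK.map (algebraMap K Ω)).eval z = (gK.roots.map fun α : K => z - (α : Ω)).prod := by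
      conv_lhs => rw [hsplit]
      rw [Polynomial.map_multiset_prod, Polynomial.eval_multiset_prod, Multiset.map_map, Multiset.map_map]
      refine congrArg Multiset.prod (Multiset.map_congr rfl fun α _ => ?_)
      simp only [Function.comp_apply, Polynomial.map_sub, Polynomial.map_X, Polynomial.map_C,
        Polynomial.eval_sub, Polynomial.eval_X, Polynomial.eval_C]
      rfl
    rw [← hmapK]
    exact h1
  have hrootV : ∀ α ∈ gK.roots, V.valuation (α : Ω) ≤ 1 := by
    intro α hα
    have h0 : gK.eval α = 0 := (Polynomial.mem_roots hgKmonic.ne_zero).mp hα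
    have h1 : (gL.map (algebraMap L Ω)).eval (α : Ω) = 0 := by
      rw [← hmapK, Polynomial.eval_map]
      show Polynomial.eval₂ (algebraMap K Ω) (algebraMap K Ω α) gK = 0
      rw [Polynomial.eval₂_hom, h0, map_zero]
    rw [heval] at h1
    exact valuation_le_one_of_root c (fun k => (V.valuation_le_one_iff _).mpr (hcV k)) h1
  -- a lift `r₀ ∈ K ∩ V` of `r`: `v(g(r₀)) < 1`
  obtain ⟨r₀, hr₀K, hr₀V, hr₀⟩ := exists_resid_eq_of_mem_residueSubfield V hrK
  have hres0 : V.valuation ((gL.map (algebraMap L Ω)).eval r₀) < 1 := by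
    rw [heval]
    have hmem : r₀ ^ n + ∑ k ∈ Finset.range n, c k * r₀ ^ k ∈ V :=
      add_mem (pow_mem hr₀V n) (sum_mem fun k _ => mul_mem (hcV k) (pow_mem hr₀V k))
    rw [← resid_eq_zero_iff V hmem, resid_add V (pow_mem hr₀V n) (sum_mem fun k _ => mul_mem (hcV k)
      (pow_mem hr₀V k)), resid_pow V hr₀V, resid_sum V _ _ fun k _ => mul_mem (hcV k) (pow_mem hr₀V k)]
    have hterm : ∀ k ∈ Finset.range n, resid V (c k * r₀ ^ k) = ((q.coeff k : kL) : ResidueField V) * r ^ k :=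
      fun k _ => by rw [resid_mul V (hcV k) (pow_mem hr₀V k), resid_pow V hr₀V, hc, hr₀]
    rw [Finset.sum_congr rfl hterm, hr₀]
    -- this is `aeval r q = 0`
    have haeval := minpoly.aeval kL r
    rw [Polynomial.aeval_eq_sum_range, ← hq, ← hn, Finset.sum_range_succ] at haeval
    have hlead : (q.coeff n : kL) = 1 := hqmonic.coeff_natDegree
    rw [hlead, one_smul] at haeval
    rw [add_comm]
    convert haeval using 2
    refine Finset.sum_congr rfl fun k _ => ?_
    rw [Algebra.smul_def]
    rfl
  -- hence some root of `gK` is congruent to `r₀`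
  obtain ⟨α, hα, hαr⟩ : ∃ α ∈ gK.roots, V.valuation (r₀ - (α : Ω)) < 1 := by
    by_contra hnone
    push Not at hnone
    have h1 : ∀ α ∈ gK.roots, V.valuation (r₀ - (α : Ω)) = 1 := fun α hα =>
      le_antisymm ((V.valuation_le_one_iff _).mpr (sub_mem hr₀V ((V.valuation_le_one_iff _).mp
        (hrootV α hα)))) (hnone α hα)
    have : V.valuation ((gL.map (algebraMap L Ω)).eval r₀) = 1 := by
      rw [hevalK, map_multiset_prod, Multiset.map_map]
      rw [Multiset.map_congr rfl fun α hα => show (⇑V.valuation ∘ fun α : K => r₀ - (α : Ω)) α = 1 from h1 α hα,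
        Multiset.map_const', Multiset.prod_replicate, one_pow]
    exact (lt_irrefl _) (this ▸ hres0)
  set a : Ω := (α : Ω) with ha
  have haK : a ∈ K := α.2
  have haV : a ∈ V := (V.valuation_le_one_iff _).mp (hrootV α hα)
  have har : resid V a = r := by
    rw [← hr₀, eq_comm, resid_eq_resid_iff V hr₀V haV]
    exact hαr
  -- `a` is a root of `gL`: `[L(a) : L] ≤ n`
  have haroot : Polynomial.aeval a gL = 0 := by
    have h0 : gK.eval α = 0 := (Polynomial.mem_roots hgKmonic.ne_zero).mp hα
    rw [Polynomial.aeval_def, ← Polynomial.eval_map, ← hmapK, Polynomial.eval_map]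
    show Polynomial.eval₂ (algebraMap K Ω) (algebraMap K Ω α) gK = 0
    rw [Polynomial.eval₂_hom, h0, map_zero]
  have hint : IsIntegral L a := ⟨gL, hgLmonic, by rwa [Polynomial.aeval_def] at haroot⟩
  set La := IntermediateField.adjoin L ({a} : Set Ω) with hLa
  have hLLa : L ≤ La.toSubfield := subfield_le_toSubfield La
  have hext : Subfield.extendScalars hLLa = La :=
    IntermediateField.toSubfield_injective (Subfield.extendScalars_toSubfield hLLa)
  have hfin : Subfield.relfinrank L La.toSubfield = (minpoly L a).natDegree := by
    rw [Subfield.relfinrank_eq_finrank_of_le hLLa, hext, IntermediateField.adjoin.finrank hint]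
  refine ⟨a, haK, haV, har, hLLa, ?_, ?_⟩
  · rw [hfin]
    exact minpoly.natDegree_pos hint
  · rw [hfin]
    have h1 := minpoly.degree_le_of_ne_zero L a hgL0 haroot
    rw [Polynomial.degree_eq_natDegree (minpoly.ne_zero hint), Polynomial.degree_eq_natDegree hgL0,
      Nat.cast_le] at h1
    rw [hgLdeg] at h1
    exact h1

omit hp in
/-- Algebraicity over equal subfields. [folklore] -/
theorem isAlgebraic_of_subfield_eq {Φ : Type*} [Field Φ] {A B : Subfield Φ} (h : A = B) {x : Φ}
    (hx : IsAlgebraic A x) : IsAlgebraic B x := by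
  subst h
  exact hx

end Steps

/-! ### Lemma 4.11: the discretely valued subfield `K₀` -/

section K0

variable {V}
variable {p : ℕ} [hp : Fact p.Prime] [CharP (ResidueField V) p] [CharZero Ω]

/-- **Kuhlmann 2010, Lemma 4.11 (the subfield `K₀`)**: "In this case [`char K = 0`], `K`
contains `ℚ` and its valuation induces the `p`-adic valuation `v_p` on `ℚ`. Since `K` is
algebraically closed, it contains a subfield `K₀` such that `K̄₀ = K̄` and `vK₀ = v_pℚ = ℤvp`; this
field can be constructed as follows. Take `𝒯` to be a set of preimages for a transcendence basis
`𝒯̄` of `K̄|𝔽_p` … Now `K̄|ℚ(𝒯)‾` is an algebraic extension … By induction we successively lift all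
of these extensions, preserving their degrees … the fundamental inequality shows that they
preserve the value group as `ℚ(𝒯)`, which is `ℤvp`. The union over this tower is the desired
field `K₀`." Rendering: inside `(Ω, V)` of characteristic `0` with `char Ωv = p`, for a subfield
`K ≤ Ω` which is an algebraically closed field there is `K₀ ≤ K` with `Kv ≤ K₀v` (hence
`K₀v = Kv`) all of whose non-zero elements have value in `v(p)^ℤ`. PROVED, by Zorn's lemma on the
subfields `L ≤ K` with `vL ⊆ v(p)^ℤ` (the prime field qualifies:
`exists_valuation_eq_zpow_of_mem_bot`; chains have their union as upper bound): a maximal one has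
`Lv = Kv`, since a residue `r̄ ∉ Lv` lifts either to a residue-transcendental `a` (then
`vL(a) = vL`, Lemma 2.5: `valueSubgroup_adjoin_eq_of_isResidueTranscendental`) or, if algebraic
over `Lv`, to an `a` with `[L(a):L] ≤ [Lv(r̄):Lv] ≤ [L(a)v : Lv]`
(`exists_lift_of_isAlgebraic_residue`), forcing `(vL(a):vL) = 1` by the fundamental inequality.
[cite: Kuhlmann2010, Lemma 4.11] -/
theorem exists_subfield_discrete_residueSubfield_eq {K : Subfield Ω} (hK : IsAlgClosed K) :
    ∃ K₀ : Subfield Ω, K₀ ≤ K ∧ residueSubfield K V ≤ residueSubfield K₀ V ∧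
      ∀ a ∈ K₀, a ≠ 0 → ∃ n : ℤ, V.valuation a = V.valuation (p : Ω) ^ n := by
  classical
  set S : Set (Subfield Ω) :=
    {L | L ≤ K ∧ ∀ a ∈ L, a ≠ 0 → ∃ n : ℤ, V.valuation a = V.valuation (p : Ω) ^ n} with hS
  -- Zorn
  obtain ⟨K₀, hmax⟩ := zorn_le₀ S fun c hcS hc => by
    by_cases hce : c.Nonempty
    · refine ⟨sSup c, ⟨sSup_le fun L hL => (hcS hL).1, fun a ha ha0 => ?_⟩, fun L hL => le_sSup hL⟩
      obtain ⟨L, hL, haL⟩ := (Subfield.mem_sSup_of_directedOn hce hc.directedOn).mp ha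
      exact (hcS hL).2 a haL ha0
    · rw [Set.not_nonempty_iff_eq_empty] at hce
      subst hce
      refine ⟨⊥, ⟨bot_le, fun a ha ha0 => exists_valuation_eq_zpow_of_mem_bot V ha ha0⟩,
        fun L hL => absurd hL (Set.notMem_empty L)⟩
  obtain ⟨hK₀K, hK₀val⟩ := hmax.1
  refine ⟨K₀, hK₀K, fun r hr => ?_, hK₀val⟩
  by_contra hrno
  -- the maximality in the two cases
  have hmax' : ∀ L' : Subfield Ω, L' ≤ K → valueSubgroup L' V ≤ valueSubgroup K₀ V → K₀ ≤ L' → L' ≤ K₀ :=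
    fun L' hL'K hv hle => hmax.2 ⟨hL'K, forall_valuation_eq_zpow_of_valueSubgroup_le hK₀val hv⟩ hle
  have hadjK : ∀ {a : Ω}, a ∈ K → (IntermediateField.adjoin K₀ ({a} : Set Ω)).toSubfield ≤ K := by
    intro a haK
    have : IntermediateField.adjoin K₀ ({a} : Set Ω) ≤ Subfield.extendScalars hK₀K :=
      IntermediateField.adjoin_simple_le_iff.mpr ((Subfield.mem_extendScalars (h := hK₀K)).mpr haK)
    exact fun z hz => this hz
  by_cases halg : IsAlgebraic (residueSubfield K₀ V) r
  · ---------------------------------------------------------------- the algebraic case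
    obtain ⟨a, haK, haV, har, hLLa, hpos, hle⟩ := exists_lift_of_isAlgebraic_residue hK hK₀K hr halg
    set L' := (IntermediateField.adjoin K₀ ({a} : Set Ω)).toSubfield with hL'
    have haL' : a ∈ L' := IntermediateField.subset_adjoin K₀ ({a} : Set Ω) rfl
    have hrL' : r ∈ residueSubfield L' V := har ▸ resid_mem_residueSubfield V haL'
    obtain ⟨he, hf, hef⟩ := relIndex_mul_relfinrank_le_relfinrank V hLLa hpos
    have hnf := natDegree_minpoly_le_relfinrank_residue hLLa hf hrL' halg
    -- `e f ≤ [L' : K₀] ≤ n ≤ f`, so `e = 1`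
    have he1 : (valueSubgroup K₀ V).relIndex (valueSubgroup L' V) = 1 := by
      refine le_antisymm (Nat.le_of_mul_le_mul_right ?_ hf) he
      rw [one_mul]
      exact hef.trans (hle.trans hnf)
    have hv : valueSubgroup L' V ≤ valueSubgroup K₀ V := Subgroup.relIndex_eq_one.mp he1
    have hL'K₀ : L' ≤ K₀ := hmax' L' (hadjK haK) hv hLLa
    exact hrno (har ▸ resid_mem_residueSubfield V (hL'K₀ haL'))
  · ---------------------------------------------------------------- the transcendental case
    obtain ⟨a, haK, haV, har⟩ := exists_resid_eq_of_mem_residueSubfield V hr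
    have hx : IsResidueTranscendental V K₀ a := by
      refine ⟨haV, fun halg' => halg ?_⟩
      rw [← har, resid_of_mem V haV]
      exact isAlgebraic_of_subfield_eq (residueSubfield_subfield_eq_resField (V := V) K₀).symm halg'
    set L' := (IntermediateField.adjoin K₀ ({a} : Set Ω)).toSubfield with hL'
    have haL' : a ∈ L' := IntermediateField.subset_adjoin K₀ ({a} : Set Ω) rfl
    have hv : valueSubgroup L' V ≤ valueSubgroup K₀ V :=
      (valueSubgroup_adjoin_eq_of_isResidueTranscendental V hx).le
    have hL'K₀ : L' ≤ K₀ := hmax' L' (hadjK haK) hv (subfield_le_toSubfield _)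
    exact hrno (har ▸ resid_mem_residueSubfield V (hL'K₀ haL'))

end K0

end Literature.AlgebraicGeometry.Resolution
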